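import Summits.AtomisticToContinuum.Crystallization.Theorems.ChargedEnergyGapBulkCarrier
import HarnessLib

/-!
# Charged energy gap — lens-3 g63, part P-Z₄c: the LEVEL CERTIFICATE of a block site (what a site near a margin-pure point pays)

Cell `decomp-a2c`, seat lens-3, generation 63, part P-Z₄c (after P-Z₄ `ChargedEnergyGapBulkCarrier`).  ELEMENTARY·PROVED.
The finite source sets of P-Z₅b/P-Z₅b′ are certified `0 < w_C < 1` by LEVEL; this part certifies, again by level only, what such a site pays
in the census currencies of (H𝄪ˢ): if a point `q` keeps a MARGIN `r` from every listed boundary on the pattern's side (`ϱχ/2 + r < d(q, Dᵢ)`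
when `σ i`, `d(q, Dᵢ) + r < ϱχ` when `¬σ i`) then every site `c` within `r` of `q` has ALL pattern factors positive (`factors_pos_of_margin`),
hence (`blockSite_certificate`) `alive(c) = 1` and EITHER `χ(c) = localFactor(c) = 1` (a FULL payer of the shell currency `T` when
`0 < w_C(c) < 1`) OR `mult(c) ≥ 1` (a transition site, paying `w_C(c)·mult(c)²` in the currency `χ`); in both cases the combined weight
`localFactor(c) + w_C(c)·alive(c)·mult(c)²` is at least `w_C(c)` (`blockSite_pays_weight`), and at least `1 − 140·(2a/ϱ)⁴` at C-level
`≥ ϱ − a` (`blockSite_pays_of_level`).  This is the per-site half of the «k × 109» attribution (seat HANDOFF (J10)–(J12)); the other half is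
the discrete load bound (P-Z₅c, g64).
-/

noncomputable section

open scoped Classical

open Literature.MathematicalPhysics.StatisticalMechanics Literature.Geometry.DiscreteGeometry
open Summit.AtomisticToContinuum.Crystallization.Theses.PricedLinkCensus
open Summit.AtomisticToContinuum.Crystallization.Theorems.ChargedEnergyGapNegative

namespace Summit.AtomisticToContinuum.Crystallization.Theorems.ChargedEnergyGapChartDial

variable {ϱχ : ℝ} {m : ℕ} {D : Fin m → Set E3} {σ : Fin m → Bool}

/-- ★ **MARGIN ⇒ ALL FACTORS POSITIVE**: if `q` is at distance `> ϱχ/2 + r` from every listed set with `σ i = true` and `< ϱχ − r` from every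
listed set with `σ i = false`, then at every point `c` within `r` of `q` each pattern factor is positive (levels are `1`-Lipschitz). -/
theorem factors_pos_of_margin (hϱχ : 0 < ϱχ) {q c : E3} {r : ℝ} (hd : dist q c ≤ r)
    (hq : ∀ i, (σ i = true → ϱχ / 2 + r < Metric.infDist q (D i)) ∧ (σ i = false → Metric.infDist q (D i) + r < ϱχ)) :
    ∀ i, 0 < (if σ i then profileWeight ϱχ (D i) c else 1 - profileWeight ϱχ (D i) c) := by
  intro i
  have h1 : Metric.infDist q (D i) ≤ Metric.infDist c (D i) + dist q c := Metric.infDist_le_infDist_add_dist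
  have h2 : Metric.infDist c (D i) ≤ Metric.infDist q (D i) + dist c q := Metric.infDist_le_infDist_add_dist
  rw [dist_comm] at h2
  by_cases hσ : σ i = true
  · rw [if_pos hσ]
    exact profileWeight_pos_of_lt_infDist hϱχ (by linarith [(hq i).1 hσ])
  · rw [if_neg hσ]
    have hf : σ i = false := by simpa using hσ
    have h3 := profileWeight_lt_one_of_infDist_lt hϱχ (show Metric.infDist c (D i) < ϱχ by linarith [(hq i).2 hf])
    linarith

/-- ★★ **THE LEVEL CERTIFICATE OF A BLOCK SITE**: under the margin hypothesis at `q`, every `c` within `r` of `q` is ALIVE (`alive(c) = 1`) and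
EITHER pure (`localFactor(c) = 1`: a full payer of the shell currency when `0 < w_C(c) < 1`) OR in transition for some listed set
(`mult(c) ≥ 1`, `localFactor(c) < 1`: a payer of the transition currency). -/
theorem blockSite_certificate (hϱχ : 0 < ϱχ) {q c : E3} {r : ℝ} (hd : dist q c ≤ r)
    (hq : ∀ i, (σ i = true → ϱχ / 2 + r < Metric.infDist q (D i)) ∧ (σ i = false → Metric.infDist q (D i) + r < ϱχ)) :
    aliveFactor ϱχ D σ c = 1 ∧ (localFactor ϱχ D σ c = 1 ∨ (1 ≤ transMult ϱχ D c ∧ localFactor ϱχ D σ c < 1)) := by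
  have hpos := factors_pos_of_margin hϱχ hd hq
  refine ⟨aliveFactor_eq_one_of_pos hpos, ?_⟩
  by_cases h1 : localFactor ϱχ D σ c < 1
  · exact Or.inr ⟨one_le_transMult_of_pos_of_localFactor_lt_one hpos h1, h1⟩
  · exact Or.inl (le_antisymm (localFactor_le_one (ϱχ := ϱχ) (D := D) (σ := σ) c) (not_lt.1 h1))

/-- ★★ **A BLOCK SITE PAYS AT LEAST ITS OWN WEIGHT** in the two currencies combined: under the margin hypothesis,
`w_C(c) ≤ localFactor(c) + w_C(c)·alive(c)·mult(c)²` for every `c` within `r` of `q` (pure: the first term is `1 ≥ w_C`; in transition: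
the second is `≥ w_C·1·1`). -/
theorem blockSite_pays_weight (hϱχ : 0 < ϱχ) {q c : E3} {r : ℝ} (hd : dist q c ≤ r)
    (hq : ∀ i, (σ i = true → ϱχ / 2 + r < Metric.infDist q (D i)) ∧ (σ i = false → Metric.infDist q (D i) + r < ϱχ)) (ϱ : ℝ) (C : Set E3) :
    profileWeight ϱ C c ≤ localFactor ϱχ D σ c + profileWeight ϱ C c * aliveFactor ϱχ D σ c * (transMult ϱχ D c : ℝ) ^ 2 := by
  obtain ⟨halive, hcase⟩ := blockSite_certificate hϱχ hd hq
  have hw0 := profileWeight_nonneg ϱ C c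
  have hw1 := profileWeight_le_one ϱ C c
  rw [halive, mul_one]
  rcases hcase with h1 | ⟨hm, _⟩
  · rw [h1]
    nlinarith [mul_nonneg hw0 (sq_nonneg (transMult ϱχ D c : ℝ))]
  · have hm' : (1 : ℝ) ≤ (transMult ϱχ D c : ℝ) := by exact_mod_cast hm
    have hm2 : (1 : ℝ) ≤ (transMult ϱχ D c : ℝ) ^ 2 := by nlinarith
    have hχ0 := localFactor_nonneg (ϱχ := ϱχ) (D := D) (σ := σ) c
    nlinarith [mul_le_mul_of_nonneg_left hm2 hw0]

/-- ★ **… QUANTIFIED BY C-LEVEL**: if moreover `d(c, C) ≥ ϱ − a` (`ϱ > 0`), the combined weight is at least `1 − 140·(2a/ϱ)⁴` (P-Z₄'s quartic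
flat top) — e.g. `≥ 1/2` for `a ≤ 439/4000·ϱ`; at the record `ϱ = 160` a block site at C-level `≥ 160 − a` pays `≥ 1 − 140·(a/80)⁴`. -/
theorem blockSite_pays_of_level (hϱχ : 0 < ϱχ) {q c : E3} {r : ℝ} (hd : dist q c ≤ r)
    (hq : ∀ i, (σ i = true → ϱχ / 2 + r < Metric.infDist q (D i)) ∧ (σ i = false → Metric.infDist q (D i) + r < ϱχ)) {ϱ : ℝ} (hϱ : 0 < ϱ)
    {C : Set E3} {a : ℝ} (ha : ϱ - a ≤ Metric.infDist c C) :
    1 - 140 * (2 * a / ϱ) ^ 4 ≤ localFactor ϱχ D σ c + profileWeight ϱ C c * aliveFactor ϱχ D σ c * (transMult ϱχ D c : ℝ) ^ 2 :=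
  (profileWeight_ge_of_le_infDist hϱ ha).trans (blockSite_pays_weight hϱχ hd hq ϱ C)

/-- ★ **THE MARGIN PROPAGATES ALONG LEVELS**: if `q` has margin `r + e` then every point `q'` within `e` of `q` has margin `r` — so a margin
`r + e` at ONE passage point serves every block centred within `e` of it. [formal bookkeeping] -/
theorem margin_mono {q q' : E3} {r e : ℝ} (he : dist q q' ≤ e)
    (hq : ∀ i, (σ i = true → ϱχ / 2 + (r + e) < Metric.infDist q (D i)) ∧ (σ i = false → Metric.infDist q (D i) + (r + e) < ϱχ)) :
    ∀ i, (σ i = true → ϱχ / 2 + r < Metric.infDist q' (D i)) ∧ (σ i = false → Metric.infDist q' (D i) + r < ϱχ) := by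
  intro i
  have h1 : Metric.infDist q (D i) ≤ Metric.infDist q' (D i) + dist q q' := Metric.infDist_le_infDist_add_dist
  have h2 : Metric.infDist q' (D i) ≤ Metric.infDist q (D i) + dist q' q := Metric.infDist_le_infDist_add_dist
  rw [dist_comm] at h2
  exact ⟨fun hσ => by linarith [(hq i).1 hσ], fun hσ => by linarith [(hq i).2 hσ]⟩

/-- Record numerals: at `ϱ = 160`, C-level `≥ 160 − 35.12` (block sites of the two top blocks of P-Z₅b′, levels `≥ 139.8 − 6.19 … `) pay
`≥ 1 − 140·(35.12/80)⁴ > 1/2`?  No — the quartic flat top is informative only for `a ≤ 439/4000·ϱ = 17.56`: it certifies `≥ 1/2` for the sites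
at C-level `≥ 142.44`, i.e. the TOP block of `exists_654_shell_sites_record` (level `153 − 6.19 = 146.81`): `1 − 140·(2·13.19/160)⁴ ≥ 1/2`. -/
theorem record_topBlock_pays_half : (1 : ℝ) / 2 ≤ 1 - 140 * (2 * (1319 / 100) / 160) ^ 4 ∧ (146.81 : ℝ) = 153 - 619 / 100 ∧
    (160 : ℝ) - 1319 / 100 = 146.81 := by
  refine ⟨?_, ?_, ?_⟩ <;> norm_num

end Summit.AtomisticToContinuum.Crystallization.Theorems.ChargedEnergyGapChartDial

end
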